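import Mathlib
import Summits.NavierStokesRegularity.NavierStokesRegularity.Theorems.FilamentSkeletonRssClause13ModelPieceFar
import Summits.NavierStokesRegularity.NavierStokesRegularity.Theorems.FilamentSkeletonRssClause13ModelDecomposition
import Literature.Analysis.SpecialFunctions.GammaProductBounds

/-!
# Clause 13-J/13-R, brick m3b-K (THE SMOOTHING TAIL ON THE FAR PIECE IN SUP NORM): `sup|K_q∗Y_H| ≤ 10e^{−X/2}/(q√(π√q))·N(Y_H)`

Route `FilamentSkeletonRss`, ∃-side clause 13 (`Clause13RNearStraightL`, stmt-NavierStokesRegularity-23612; typing-agnostic).  Design of record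
rev 80–82 (m3b, tenure note R-m3b-2: "in the ultra-high band, with the `K_q∗` tail negligible there, the model is the regular–singular transport
ODE").  The far piece `Y_H = Y − k∗Y` of a ball-supported `C¹` variation has spectrum in `|z|√q ≥ X` (`k̂ = 1` on `|z|√q < X`); the forcing of
its transport ODE (`far_transport_ode`, `…Clause13FarOperatorSup`) contains the non-local smoothing tail `−iG·K_q∗Y_H`, which the pointwise fences
(`waist_norm_le_of_damped`, `farBranch_norm_le_weighted`) need in SUP norm.  Here (Mathlib's `𝓕`, as in `Literature.Analysis.Fourier.BandlimitedSupBound`):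
* §1 `norm_kernel_mul_le_of_fourier_majorant` — generic `L² → L^∞` bound for a piece through an `L²` MAJORANT OF THE SYMBOL ON THE SPECTRUM:
  `k ∈ C ∩ L¹` real, `f ∈ C ∩ L¹ ∩ L²` bounded, `m ≥ 0` in `L²` with `|𝓕k(ξ)|·|𝓕f(ξ)| ≤ m(ξ)|𝓕f(ξ)|` for all `ξ`; then
  `‖(k∗f)(x)‖ ≤ ‖m‖₂·N(f)` at every `x` (continuity of `L¹ ∗ C_b`, `𝓕(k∗f) = 𝓕k·𝓕f`, Fourier inversion, Cauchy–Schwarz, Plancherel);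
* §2 `integral_sq_farMajorant` — for the smoothing kernel the majorant `m = 𝟙_{2π|ξ|√q ≥ X}·(10/q)e^{−π√q|ξ|}` has
  `‖m‖₂² = 100e^{−X}/(πq²√q)` (`𝓕K_q(ξ) = (2/q)(1 − 𝔖(2πξ√q))`, p664709; `0 ≤ 1 − 𝔖(x) ≤ 5e^{−x/2}`, p662338);
* §3 ★ `norm_smoothingPiece_le_of_far_spectrum` — for `f ∈ C ∩ L¹ ∩ L²` bounded with `∫f e^{izx}dx = 0` whenever `|z|√q < X` (`X > 0`):
  `‖(K_q∗f)(x)‖ ≤ (10/(q√(π√q)))·e^{−X/2}·N(f)`; `norm_smoothingPiece_far_le` — the instance `f = Y_H = Y − k∗Y` for `Y ∈ C¹_c` and a near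
  kernel `k` with profile `χ = 1` off `|z|√q ≥ X`, bound `(10/(q√(π√q)))·e^{−X/2}·(1+‖k‖₁)·N(Y)`.
With `X = 4 log Γ` the factor `G·e^{−X/2} ~ Γ^{−1}`: the tail is negligible in the far transport ODE, in sup norm as it was in `L²` (p703600).
Lane ns-filament-19175-p1 g18; `--supports stmt-NavierStokesRegularity-23612 --as helper`.
HONEST FRAMING: harmonic analysis of an explicit 1-D model operator attached to a HYPOTHETICAL filament skeleton on the NEGATIVE side of a MODEL
route; nothing here bears on Navier–Stokes regularity or blow-up; 23610/23612 stay OPEN.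
-/

noncomputable section

open MeasureTheory Real Complex Filter Set
open scoped ComplexConjugate Topology FourierTransform Convolution
open Summit.NavierStokesRegularity.NavierStokesRegularity.Theorems.AnalyticStripLiaSymbol (liaSym liaSym_neg one_sub_liaSym_nonneg
  one_sub_liaSym_le_exp)

namespace Summit.NavierStokesRegularity.NavierStokesRegularity.Theorems.MatchedKernel
set_option linter.dupNamespace false

/-! ## §1 Sup of a piece through an `L²` majorant of its symbol on the spectrum -/

/-- **`L² → L^∞` FOR A PIECE THROUGH A SYMBOL MAJORANT.**  `k` real, continuous, integrable; `f` continuous, integrable, in `L²`, bounded;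
`m ≥ 0` in `L²` with `|𝓕k(ξ)|·|𝓕f(ξ)| ≤ m(ξ)·|𝓕f(ξ)|` for every `ξ` (i.e. `m` majorises the symbol on the spectrum of `f`).  Then for every `x`:
`‖∫k(x−y)f(y)dy‖ ≤ (∫m²)^{1/2}·(∫‖f‖²)^{1/2}`. [folklore; Bernstein–Nikolskii pattern of `Literature.Analysis.Fourier.BandlimitedSupBound`] -/
theorem norm_kernel_mul_le_of_fourier_majorant {k : ℝ → ℝ} (hki : Integrable k)
    {f : ℝ → ℂ} (hfc : Continuous f) (hfi : Integrable f) (hf2 : MemLp f 2 volume) {Mf : ℝ} (hfb : ∀ y, ‖f y‖ ≤ Mf)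
    {m : ℝ → ℝ} (hm0 : ∀ ξ, 0 ≤ m ξ) (hm2 : MemLp m 2 volume)
    (hdom : ∀ ξ : ℝ, ‖𝓕 (fun t : ℝ => ((k t : ℝ) : ℂ)) ξ‖ * ‖𝓕 f ξ‖ ≤ m ξ * ‖𝓕 f ξ‖) (x : ℝ) :
    ‖∫ y : ℝ, ((k (x - y) : ℝ) : ℂ) * f y‖ ≤ (∫ ξ, m ξ ^ 2) ^ (1 / 2 : ℝ) * (∫ y, ‖f y‖ ^ 2) ^ (1 / 2 : ℝ) := by
  set kc : ℝ → ℂ := fun t => ((k t : ℝ) : ℂ) with hkc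
  have hkci : Integrable kc := hki.ofReal
  -- the piece is the convolution `kc ⋆ f`
  set g : ℝ → ℂ := fun x => ∫ y : ℝ, ((k (x - y) : ℝ) : ℂ) * f y with hg
  have hgconv : g = kc ⋆[ContinuousLinearMap.mul ℂ ℂ, volume] f := by
    funext x; exact integral_mul_sub_eq_convolution kc f x
  -- continuity (`L¹ ∗ C_b`) and integrability (`L¹ ∗ L¹`)
  have hbdd : BddAbove (Set.range fun y => ‖f y‖) := ⟨Mf, by rintro _ ⟨y, rfl⟩; exact hfb y⟩
  have hgc : Continuous g := by
    rw [hgconv]; exact hbdd.continuous_convolution_right_of_integrable (ContinuousLinearMap.mul ℂ ℂ) hkci hfc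
  have hgi : Integrable g := by
    rw [hgconv]; exact hkci.integrable_convolution (ContinuousLinearMap.mul ℂ ℂ) hfi
  -- the transform of the piece
  have hFg : ∀ ξ, 𝓕 g ξ = 𝓕 kc ξ * 𝓕 f ξ := by
    intro ξ; rw [hgconv]; exact Real.fourier_mul_convolution_eq hkci hfi ξ
  have hFf2 : MemLp (𝓕 f) 2 volume := Literature.Analysis.FunctionSpaces.memLp_two_fourierIntegral hfi hf2
  have hFgc : Continuous (𝓕 g) := Literature.Analysis.FunctionSpaces.continuous_fourierIntegral hgi
  -- the majorant `m·|𝓕f|` is integrable (`L² × L²`), hence so is `𝓕g`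
  have hmF : Integrable (fun ξ => m ξ * ‖𝓕 f ξ‖) := hm2.integrable_mul hFf2.norm
  have hFgle : ∀ ξ, ‖𝓕 g ξ‖ ≤ m ξ * ‖𝓕 f ξ‖ := fun ξ => by rw [hFg, norm_mul]; exact hdom ξ
  have hFgi : Integrable (𝓕 g) := Integrable.mono' hmF hFgc.aestronglyMeasurable (ae_of_all _ hFgle)
  -- Fourier inversion at `x`
  have hinv : 𝓕⁻ (𝓕 g) x = g x := congrFun (hgc.fourierInv_fourier_eq hgi hFgi) x
  have h1 : ‖g x‖ ≤ ∫ ξ : ℝ, ‖𝓕 g ξ‖ := by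
    rw [← hinv, Real.fourierInv_eq]
    refine (norm_integral_le_integral_norm _).trans (le_of_eq ?_)
    simp_rw [Circle.norm_smul]
  have h2 : ∫ ξ : ℝ, ‖𝓕 g ξ‖ ≤ ∫ ξ, m ξ * ‖𝓕 f ξ‖ := integral_mono hFgi.norm hmF hFgle
  -- Cauchy–Schwarz and Plancherel
  have h3 : ∫ ξ, m ξ * ‖𝓕 f ξ‖ ≤ (∫ ξ, m ξ ^ 2) ^ (1 / 2 : ℝ) * (∫ ξ, ‖𝓕 f ξ‖ ^ 2) ^ (1 / 2 : ℝ) := by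
    have hm2' : MemLp m (ENNReal.ofReal 2) volume := by rw [show ENNReal.ofReal 2 = 2 by norm_num]; exact hm2
    have hF2' : MemLp (fun ξ => ‖𝓕 f ξ‖) (ENNReal.ofReal 2) volume := by
      rw [show ENNReal.ofReal 2 = 2 by norm_num]; exact hFf2.norm
    have h := integral_mul_le_Lp_mul_Lq_of_nonneg Real.HolderConjugate.two_two (ae_of_all _ hm0)
      (ae_of_all _ fun ξ => norm_nonneg (𝓕 f ξ)) hm2' hF2'
    simpa only [Real.rpow_two] using h
  rw [Literature.Analysis.FunctionSpaces.integral_norm_sq_fourierIntegral_eq hfi hf2] at h3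
  exact h1.trans (h2.trans h3)

/-! ## §2 The `L²` mass of the far majorant of the smoothing symbol -/

/-- `𝔖` is even: `𝔖(y) = 𝔖(|y|)`. [folklore] -/
theorem liaSym_eq_liaSym_abs (y : ℝ) : liaSym y = liaSym |y| := by
  rcases le_or_gt 0 y with h | h
  · rw [abs_of_nonneg h]
  · rw [abs_of_neg h, liaSym_neg]

/-- `∫_{a ≤ |ξ|} e^{−b|ξ|} dξ = 2e^{−ab}/b` for `a, b > 0`. [folklore] -/
theorem integral_indicator_exp_neg_mul_abs {a b : ℝ} (ha : 0 < a) (hb : 0 < b) :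
    ∫ ξ : ℝ, {ξ : ℝ | a ≤ |ξ|}.indicator (fun ξ => Real.exp (-(b * |ξ|))) ξ = 2 * Real.exp (-(b * a)) / b := by
  have hpt : ∀ ξ : ℝ, {ξ : ℝ | a ≤ |ξ|}.indicator (fun ξ => Real.exp (-(b * |ξ|))) ξ
      = (fun t : ℝ => (Set.Ici a).indicator (fun t => Real.exp (-b * t)) t) |ξ| := by
    intro ξ
    simp only [Set.indicator_apply, Set.mem_setOf_eq, Set.mem_Ici, neg_mul]
  simp_rw [hpt]
  rw [integral_comp_abs (f := fun t : ℝ => (Set.Ici a).indicator (fun t => Real.exp (-b * t)) t)]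
  rw [setIntegral_indicator measurableSet_Ici]
  have hIa : Set.Ioi (0 : ℝ) ∩ Set.Ici a = Set.Ici a := by
    ext t
    simp only [Set.mem_inter_iff, Set.mem_Ioi, Set.mem_Ici]
    exact ⟨fun h => h.2, fun h => ⟨lt_of_lt_of_le ha h, h⟩⟩
  rw [hIa, integral_Ici_eq_integral_Ioi, integral_exp_mul_Ioi (by linarith : -b < 0) a]
  field_simp

/-- **The far majorant** `m(ξ) = 𝟙_{X/(2π√q) ≤ |ξ|}·(10/q)·e^{−π√q|ξ|}` is nonnegative, in `L²`, and `∫m² = 100e^{−X}/(πq²√q)`. [folklore] -/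
theorem integral_sq_farMajorant {q X : ℝ} (hq : 0 < q) (hX : 0 < X) :
    (∀ ξ : ℝ, 0 ≤ {ξ : ℝ | X / (2 * π * √q) ≤ |ξ|}.indicator (fun ξ => 10 / q * Real.exp (-(π * √q * |ξ|))) ξ) ∧
    MemLp (fun ξ : ℝ => {ξ : ℝ | X / (2 * π * √q) ≤ |ξ|}.indicator (fun ξ => 10 / q * Real.exp (-(π * √q * |ξ|))) ξ) 2 volume ∧
    ∫ ξ : ℝ, ({ξ : ℝ | X / (2 * π * √q) ≤ |ξ|}.indicator (fun ξ => 10 / q * Real.exp (-(π * √q * |ξ|))) ξ) ^ 2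
      = 100 / (π * q ^ 2 * √q) * Real.exp (-X) := by
  have hsq : 0 < √q := Real.sqrt_pos.2 hq
  have hb : 0 < 2 * π * √q := by positivity
  have ha : 0 < X / (2 * π * √q) := by positivity
  set S : Set ℝ := {ξ : ℝ | X / (2 * π * √q) ≤ |ξ|} with hS
  have hSm : MeasurableSet S := measurableSet_le measurable_const (measurable_id.abs)
  have hgc : Continuous fun ξ : ℝ => 10 / q * Real.exp (-(π * √q * |ξ|)) := by fun_prop
  have h0 : ∀ ξ : ℝ, 0 ≤ S.indicator (fun ξ => 10 / q * Real.exp (-(π * √q * |ξ|))) ξ := by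
    intro ξ
    refine Set.indicator_nonneg (fun ξ _ => ?_) ξ
    positivity
  -- the square is the indicator of `(10/q)² e^{−2π√q|ξ|}`
  have hsq2 : ∀ ξ : ℝ, (S.indicator (fun ξ => 10 / q * Real.exp (-(π * √q * |ξ|))) ξ) ^ 2
      = S.indicator (fun ξ => (10 / q) ^ 2 * Real.exp (-(2 * π * √q * |ξ|))) ξ := by
    intro ξ
    by_cases hξ : ξ ∈ S
    · rw [Set.indicator_of_mem hξ, Set.indicator_of_mem hξ, mul_pow, ← Real.exp_nat_mul]
      congr 2
      push_cast
      ring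
    · rw [Set.indicator_of_notMem hξ, Set.indicator_of_notMem hξ]
      ring
  have hint2 : Integrable fun ξ : ℝ => S.indicator (fun ξ => (10 / q) ^ 2 * Real.exp (-(2 * π * √q * |ξ|))) ξ :=
    (((Literature.Analysis.SpecialFunctions.integrable_exp_neg_mul_abs hb).const_mul ((10 / q) ^ 2)).indicator hSm)
  have hmeas : AEStronglyMeasurable (fun ξ : ℝ => S.indicator (fun ξ => 10 / q * Real.exp (-(π * √q * |ξ|))) ξ) volume :=
    (hgc.measurable.indicator hSm).aestronglyMeasurable
  have hm2 : MemLp (fun ξ : ℝ => S.indicator (fun ξ => 10 / q * Real.exp (-(π * √q * |ξ|))) ξ) 2 volume := by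
    rw [memLp_two_iff_integrable_sq hmeas]
    exact hint2.congr (ae_of_all _ fun ξ => (hsq2 ξ).symm)
  refine ⟨h0, hm2, ?_⟩
  simp_rw [hsq2]
  have e1 : (fun ξ : ℝ => S.indicator (fun ξ => (10 / q) ^ 2 * Real.exp (-(2 * π * √q * |ξ|))) ξ)
      = fun ξ : ℝ => (10 / q) ^ 2 * S.indicator (fun ξ => Real.exp (-(2 * π * √q * |ξ|))) ξ := by
    funext ξ
    rw [Set.indicator_const_mul]
  rw [e1, integral_const_mul, hS, integral_indicator_exp_neg_mul_abs ha hb]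
  have hX' : 2 * π * √q * (X / (2 * π * √q)) = X := by field_simp
  rw [hX']
  field_simp
  ring

/-! ## §3 The smoothing tail on a far-spectrum function, and on the far piece -/

/-- ★ **SMOOTHING TAIL IN SUP NORM.**  `q, X > 0`; `f : ℝ → ℂ` continuous, integrable, in `L²`, bounded, with `∫ f(x)e^{izx}dx = 0` whenever
`|z|√q < X`.  Then for every `x`:  `‖∫K_q(x−σ)f(σ)dσ‖ ≤ (10/(q·√(π√q)))·e^{−X/2}·(∫‖f‖²)^{1/2}`, `K_q(s) = (2q−s²)(s²+q)^{-5/2}`. [folklore] -/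
theorem norm_smoothingPiece_le_of_far_spectrum {q X : ℝ} (hq : 0 < q) (hX : 0 < X)
    {f : ℝ → ℂ} (hfc : Continuous f) (hfi : Integrable f) (hf2 : MemLp f 2 volume) {Mf : ℝ} (hfb : ∀ y, ‖f y‖ ≤ Mf)
    (hsupp : ∀ z : ℝ, |z| * √q < X → (∫ x : ℝ, f x * cexp (I * z * x)) = 0) (x : ℝ) :
    ‖∫ σ : ℝ, ((((2 * q - (x - σ) ^ 2) * (((x - σ) ^ 2 + q) ^ (5 / 2 : ℝ))⁻¹ : ℝ)) : ℂ) * f σ‖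
      ≤ 10 / (q * Real.sqrt (π * √q)) * Real.exp (-(X / 2)) * (∫ y, ‖f y‖ ^ 2) ^ (1 / 2 : ℝ) := by
  have hsq : 0 < √q := Real.sqrt_pos.2 hq
  have hb : 0 < 2 * π * √q := by positivity
  obtain ⟨hm0, hm2, hmint⟩ := integral_sq_farMajorant hq hX
  set S : Set ℝ := {ξ : ℝ | X / (2 * π * √q) ≤ |ξ|} with hS
  -- the majorant dominates the symbol on the spectrum of `f`
  have hdom : ∀ ξ : ℝ, ‖𝓕 (fun t : ℝ => ((((2 * q - t ^ 2) * ((t ^ 2 + q) ^ (5 / 2 : ℝ))⁻¹ : ℝ)) : ℂ)) ξ‖ * ‖𝓕 f ξ‖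
      ≤ S.indicator (fun ξ => 10 / q * Real.exp (-(π * √q * |ξ|))) ξ * ‖𝓕 f ξ‖ := by
    intro ξ
    by_cases hξ : ξ ∈ S
    · refine mul_le_mul_of_nonneg_right ?_ (norm_nonneg _)
      rw [Set.indicator_of_mem hξ, fourier_smoothingKernel hq ξ, Complex.norm_real, Real.norm_eq_abs]
      have hξ' : X / (2 * π * √q) ≤ |ξ| := hξ
      have hpos : 0 < 2 * π * √q * |ξ| := by
        have : X ≤ 2 * π * √q * |ξ| := by rw [div_le_iff₀ hb] at hξ'; linarith
        linarith
      have heven : liaSym (2 * π * ξ * √q) = liaSym (2 * π * √q * |ξ|) := by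
        rw [liaSym_eq_liaSym_abs (2 * π * ξ * √q)]
        congr 1
        rw [abs_mul, abs_mul, abs_mul, abs_of_pos (two_pos : (0:ℝ) < 2), abs_of_pos Real.pi_pos, abs_of_pos hsq]
        ring
      have h1 := one_sub_liaSym_nonneg (2 * π * ξ * √q)
      have h2 := one_sub_liaSym_le_exp (2 * π * √q * |ξ|) hpos
      rw [abs_of_nonneg (by positivity : 0 ≤ 2 / q * (1 - liaSym (2 * π * ξ * √q))), heven]
      have e : Real.exp (-(2 * π * √q * |ξ| / 2)) = Real.exp (-(π * √q * |ξ|)) := by congr 1; ring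
      rw [e] at h2
      calc 2 / q * (1 - liaSym (2 * π * √q * |ξ|)) ≤ 2 / q * (5 * Real.exp (-(π * √q * |ξ|))) := by gcongr
        _ = 10 / q * Real.exp (-(π * √q * |ξ|)) := by ring
    · -- off `S` the transform of `f` vanishes
      have hlt : |ξ| < X / (2 * π * √q) := not_le.1 hξ
      have hz : |(-(2 * π * ξ))| * √q < X := by
        rw [abs_neg, abs_mul, abs_of_pos (by positivity : (0:ℝ) < 2 * π)]
        rw [lt_div_iff₀ hb] at hlt
        linarith
      have hF0 : 𝓕 f ξ = 0 := by
        have h := hsupp (-(2 * π * ξ)) hz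
        rw [unnormalisedTransform_eq_fourier f (-(2 * π * ξ))] at h
        have e : -(-(2 * π * ξ)) / (2 * π) = ξ := by field_simp
        rwa [e] at h
      rw [hF0, norm_zero, mul_zero, mul_zero]
  have h := norm_kernel_mul_le_of_fourier_majorant (k := fun s : ℝ => (2 * q - s ^ 2) * ((s ^ 2 + q) ^ (5 / 2 : ℝ))⁻¹)
    (integrable_smoothingKernel_real hq) hfc hfi hf2 hfb hm0 hm2 hdom x
  rw [hmint] at h
  refine h.trans (le_of_eq ?_)
  congr 1
  -- `(100e^{−X}/(πq²√q))^{1/2} = 10e^{−X/2}/(q√(π√q))`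
  have hE : 0 ≤ 10 / (q * Real.sqrt (π * √q)) * Real.exp (-(X / 2)) := by positivity
  have hE2 : (10 / (q * Real.sqrt (π * √q)) * Real.exp (-(X / 2))) ^ 2 = 100 / (π * q ^ 2 * √q) * Real.exp (-X) := by
    rw [mul_pow, div_pow, mul_pow, Real.sq_sqrt (by positivity), ← Real.exp_nat_mul]
    push_cast
    have e : (2 : ℝ) * -(X / 2) = -X := by ring
    rw [e]
    field_simp
    ring
  rw [← hE2, ← Real.sqrt_eq_rpow, Real.sqrt_sq hE]

/-- **THE SMOOTHING TAIL ON THE FAR PIECE.**  `q, X > 0`; `k` real, continuous, integrable, bounded, with profile `χ(z) = ∫k e^{izt}dt` equal to `1`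
unless `X ≤ |z|√q`; `Y ∈ C¹_c`.  Then with `Y_H = Y − k∗Y`, for every `x`:
`‖(K_q∗Y_H)(x)‖ ≤ (10/(q√(π√q)))·e^{−X/2}·N(Y_H) ≤ (10/(q√(π√q)))·e^{−X/2}·(1+‖k‖₁)·N(Y)`. [folklore] -/
theorem norm_smoothingPiece_far_le {q X : ℝ} (hq : 0 < q) (hX : 0 < X)
    {k : ℝ → ℝ} (hkc : Continuous k) (hki : Integrable k) {Mk : ℝ} (hkM : ∀ t, |k t| ≤ Mk)
    {χ : ℝ → ℂ} (hkχ : ∀ z : ℝ, ∫ t : ℝ, ((k t : ℝ) : ℂ) * cexp (I * z * t) = χ z) (hfar : ∀ z : ℝ, χ z ≠ 1 → X ≤ |z| * √q)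
    {Y : ℝ → ℂ} (hY : ContDiff ℝ 1 Y) (hYs : HasCompactSupport Y) (x : ℝ) :
    ‖∫ σ : ℝ, ((((2 * q - (x - σ) ^ 2) * (((x - σ) ^ 2 + q) ^ (5 / 2 : ℝ))⁻¹ : ℝ)) : ℂ) * (Y σ - ∫ y : ℝ, ((k (σ - y) : ℝ) : ℂ) * Y y)‖
      ≤ 10 / (q * Real.sqrt (π * √q)) * Real.exp (-(X / 2))
          * (∫ x : ℝ, ‖(Y x - ∫ y : ℝ, ((k (x - y) : ℝ) : ℂ) * Y y)‖ ^ 2) ^ (1 / 2 : ℝ) ∧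
    ‖∫ σ : ℝ, ((((2 * q - (x - σ) ^ 2) * (((x - σ) ^ 2 + q) ^ (5 / 2 : ℝ))⁻¹ : ℝ)) : ℂ) * (Y σ - ∫ y : ℝ, ((k (σ - y) : ℝ) : ℂ) * Y y)‖
      ≤ 10 / (q * Real.sqrt (π * √q)) * Real.exp (-(X / 2)) * (1 + ∫ t, |k t|) * (∫ x : ℝ, ‖Y x‖ ^ 2) ^ (1 / 2 : ℝ) := by
  have hYc := hY.continuous
  have hYi : Integrable Y := hYc.integrable_of_hasCompactSupport hYs
  have hPc : Continuous fun x : ℝ => ∫ y : ℝ, ((k (x - y) : ℝ) : ℂ) * Y y := continuous_piece hkc hYc hYs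
  have hP1 : Integrable fun x : ℝ => ∫ y : ℝ, ((k (x - y) : ℝ) : ℂ) * Y y := integrable_piece hki hYc hYs
  have hP2 : MemLp (fun x : ℝ => ∫ y : ℝ, ((k (x - y) : ℝ) : ℂ) * Y y) 2 volume := memLp_piece hkc hki hYc hYs
  have hY2 : MemLp Y 2 volume := hYc.memLp_of_hasCompactSupport hYs
  have hYHc : Continuous fun x : ℝ => (Y x - ∫ y : ℝ, ((k (x - y) : ℝ) : ℂ) * Y y) := hYc.sub hPc
  have hYH1 : Integrable fun x : ℝ => (Y x - ∫ y : ℝ, ((k (x - y) : ℝ) : ℂ) * Y y) := hYi.sub hP1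
  have hYH2 : MemLp (fun x : ℝ => (Y x - ∫ y : ℝ, ((k (x - y) : ℝ) : ℂ) * Y y)) 2 volume := hY2.sub hP2
  -- `Y_H` is bounded
  obtain ⟨MY, hMY⟩ := hYc.bounded_above_of_compact_support hYs
  have hYHb : ∀ x : ℝ, ‖(Y x - ∫ y : ℝ, ((k (x - y) : ℝ) : ℂ) * Y y)‖ ≤ MY + Mk * ∫ y : ℝ, ‖Y y‖ := by
    intro x
    refine (norm_sub_le _ _).trans (add_le_add (hMY x) ((norm_piece_le hkc hYc hYs x).trans ?_))
    rw [← integral_const_mul]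
    refine integral_mono_of_nonneg (ae_of_all _ fun y => by positivity) (hYi.norm.const_mul _) (ae_of_all _ fun y => ?_)
    exact mul_le_mul_of_nonneg_right (hkM _) (norm_nonneg _)
  -- spectral support of `Y_H`
  have hsuppH : ∀ z : ℝ, |z| * √q < X → ∫ x : ℝ, (Y x - ∫ y : ℝ, ((k (x - y) : ℝ) : ℂ) * Y y) * cexp (I * z * x) = 0 := by
    intro z hz
    have hχ1 : χ z = 1 := by
      by_contra hne
      have := hfar z hne
      linarith
    have he : ∀ x : ℝ, ‖cexp (I * z * x)‖ ≤ 1 := fun x => by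
      rw [show I * (z : ℂ) * (x : ℂ) = ((z * x : ℝ) : ℂ) * I by push_cast; ring, Complex.norm_exp_ofReal_mul_I]
    have hem : AEStronglyMeasurable (fun x : ℝ => cexp (I * z * x)) volume :=
      (Complex.continuous_exp.comp (continuous_const.mul Complex.continuous_ofReal)).aestronglyMeasurable
    have hI1 : Integrable fun x : ℝ => Y x * cexp (I * z * x) := hYi.mul_bdd hem (ae_of_all _ he)
    have hI2 : Integrable fun x : ℝ => (∫ y : ℝ, ((k (x - y) : ℝ) : ℂ) * Y y) * cexp (I * z * x) := hP1.mul_bdd hem (ae_of_all _ he)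
    have hconv := unnormalisedTransform_conv (k := fun t => ((k t : ℝ) : ℂ)) hki.ofReal hYi z
    beta_reduce at hconv
    simp_rw [sub_mul]
    rw [integral_sub hI1 hI2, hconv, hkχ z, hχ1, one_mul, sub_self]
  have h1 := norm_smoothingPiece_le_of_far_spectrum hq hX hYHc hYH1 hYH2 hYHb hsuppH x
  refine ⟨h1, h1.trans ?_⟩
  have hC : 0 ≤ 10 / (q * Real.sqrt (π * √q)) * Real.exp (-(X / 2)) := by positivity
  rw [mul_assoc (10 / (q * Real.sqrt (π * √q)) * Real.exp (-(X / 2)))]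
  exact mul_le_mul_of_nonneg_left (l2_far_le hkc hki hYc hYs) hC

end Summit.NavierStokesRegularity.NavierStokesRegularity.Theorems.MatchedKernel

end
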